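import Summits.ResolutionOfSingularities.ResolutionOfSingularities.Theorems.HilbertSamuelEliminationSigmaMaxModificationsCorridor3WLadderIsoInsepE2NearChart
import Summits.ResolutionOfSingularities.ResolutionOfSingularities.Theorems.EquisingularLiftEquisingularLiftNatConeChart
import HarnessLib

/-!
# [OURS · L1 W4.2] E2 chart calculus, brick 11: (N3a) IN THE CHART — ON THE LINE `V(x̄, ȳ)`, «NEAR ⟺ THE CUBIC CONE PASSES
# THROUGH THE POINT» (crux chain w42, cell k2 `T3insep` = `stub_isoInsepTower`; `--supports stmt-ResolutionOfSingularities-19249`)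

OURS (cell res-hironaka, slot W4.2, seat res-D-pv-042; OWN OBJECT TUO 18:19Z, (N3) continuation); NOT a statement of [Hironaka2017]
nor of [CossartJannsenSaito2020] / [CossartPiltant2008]. AI-drafted, weaker than expert review. PROOF file, def-free, fact-free.

`R` regular local with regular parameters `c : Fin d → R`, `B = R[𝔪/c_j]`, `t = c_j/1` the exceptional generator, `𝔔` a prime of `B`.
* `algebraMap_rsop_not_mem_maximalIdeal_sq` — **the exceptional generator is a regular parameter at every point of the chart**:
  `t/1 ∉ 𝔪²` in `B_𝔔` (`B/(t) ≅ κ[T_k : k ≠ j]` is regular, Stacks 0BIQ; Matsumura 14.2).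
* `strictTransform_eq_of_cubicForm` — for `h = ĉ(c_{i₀}² + λ̂c_{i₁}²) + F(c)` with `F` a cubic FORM (coefficients in `R`: all terms
  of order `≥ 3`) and `h = c_j²h′`: `h′ = ĉ(u² + λ̂v²) + t·F(c/c_j)` (`u = c_{i₀}/c_j`, `v = c_{i₁}/c_j`, `F(c/c_j)` the cone transform).
* `strictTransform_mem_sq_iff_coneTransform_mem` — **(N3a)**: at a point `𝔔 ∋ u, v` of the line, `h′ ∈ 𝔔²B_𝔔 ⟺ F(c/c_j) ∈ 𝔔`
  (the cubic cone `V(F̄₃) ⊂ ℙ^{d−1}` passes through the point); no hypothesis on `ĉ, λ̂` or the characteristic is needed here.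
* `aeval_sub_aeval_mem_of_forall_sub_mem`, `coneTransform_mem_iff_lineRestriction_mem` — on the line the cone transform may be
  replaced by the restriction `F(0, 0, c_k/c_j)` of the cubic to the plane `x = y = 0` (the binary cubic `g₃` of the memo).
-/

noncomputable section

set_option linter.dupNamespace false

open scoped Classical
open IsLocalRing MvPolynomial Literature.AlgebraicGeometry.Resolution
open Summit.ResolutionOfSingularities.ResolutionOfSingularities.Cruxes.SigmaMaxModifications.IdeasL1C5.EmbeddedStep
  (span_range_append_elim0 isRegularRing_quotient_span_rsop isRegularRing_blowupAlgebra_rsop)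
open Summit.ResolutionOfSingularities.ResolutionOfSingularities.Cruxes.EquisingularLiftNat.Sections
  (algebraMap_eval_eq_pow_mul_coneTransform)

namespace Summit.ResolutionOfSingularities.ResolutionOfSingularities.Cruxes.SigmaMaxModifications.IdeasL1C6.E2Chart

universe u

/-! ## §0. A membership helper (stated over a ring VARIABLE so that instance paths are canonical) -/

/-- `x + y ∈ I`, `x ∈ I` ⟹ `y ∈ I`. [folklore] -/
theorem mem_of_add_mem_of_mem {A : Type*} [CommRing A] (I : Ideal A) {x y : A} (hxy : x + y ∈ I) (hx : x ∈ I) : y ∈ I := by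
  have := I.sub_mem hxy hx
  rwa [add_sub_cancel_left] at this

/-! ## §1. The exceptional generator is a regular parameter everywhere on the chart -/

/-- **`c_j/1 ∉ 𝔪²` at every point of `R[𝔪/c_j]`.** For a regular local ring `R` with regular parameters `c : Fin d → R` and any prime
`𝔔` of `B = R[𝔪/c_j]`, the image of the exceptional generator `t = c_j/1` in `B_𝔔` is not in `𝔪²`: if `t ∈ 𝔔` at all then
`B_𝔔/(t) ≅ (B/(t))_𝔔 ≅ κ[T_k : k ≠ j]_𝔭` is a regular local ring and `t ≠ 0` (Matsumura 14.2). [folklore] -/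
theorem algebraMap_rsop_not_mem_maximalIdeal_sq {R : Type u} [CommRing R] [IsRegularLocalRing R] {d : ℕ}
    (hd : (maximalIdeal R).spanFinrank = d) (c : Fin d → R) (hc : Ideal.span (Set.range c) = maximalIdeal R) (j : Fin d)
    (𝔔 : Ideal (blowupAlgebra (Ideal.span (Set.range c)) (c j))) [𝔔.IsPrime] :
    algebraMap (blowupAlgebra (Ideal.span (Set.range c)) (c j)) (Localization.AtPrime 𝔔)
        (algebraMap R (blowupAlgebra (Ideal.span (Set.range c)) (c j)) (c j)) ∉
      maximalIdeal (Localization.AtPrime 𝔔) ^ 2 := by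
  set t : blowupAlgebra (Ideal.span (Set.range c)) (c j) := algebraMap R (blowupAlgebra (Ideal.span (Set.range c)) (c j)) (c j)
    with ht
  intro hmem
  by_cases ht𝔔 : t ∈ 𝔔
  · -- `B/(t)` is a regular ring (and so are `B` and `B_𝔔`)
    have hqr : IsQuasiRegular c := isQuasiRegular_centre c Fin.elim0 (span_range_append_elim0 c hc) hd
    haveI := isRegularRing_blowupAlgebra_rsop hd c hc j
    haveI := isRegularRing_quotient_span_rsop c hc
    haveI : IsRegularRing (blowupAlgebra (Ideal.span (Set.range c)) (c j) ⧸ Ideal.span {t}) :=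
      IsRegularRing.of_ringEquiv (blowupAlgebra.quotientSpanEquiv c j hqr).symm
    set mk := Ideal.Quotient.mk (Ideal.span {t}) with hmk
    have hker : RingHom.ker mk ≤ 𝔔 := by
      rw [hmk, Ideal.mk_ker]; exact (Ideal.span_singleton_le_iff_mem _).mpr ht𝔔
    haveI h𝔭' : (𝔔.map mk).IsPrime := Ideal.map_isPrime_of_surjective Ideal.Quotient.mk_surjective hker
    have hcomap : (𝔔.map mk).comap mk = 𝔔 := by
      rw [Ideal.comap_map_of_surjective _ Ideal.Quotient.mk_surjective, ← RingHom.ker_eq_comap_bot]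
      exact sup_eq_left.mpr hker
    have key := isRegularLocalRing_localization_quotient_span_singleton t (𝔔.map mk)
    have key' := isRegularLocalRing_quotient_congr_prime hcomap t key
    -- `t/1 ≠ 0`: `t` is a non-zero-divisor of `B`
    have ht0 : algebraMap (blowupAlgebra (Ideal.span (Set.range c)) (c j)) (Localization.AtPrime 𝔔) t ≠ 0 := by
      intro h0
      obtain ⟨m, hm⟩ := (IsLocalization.map_eq_zero_iff 𝔔.primeCompl (Localization.AtPrime 𝔔) t).mp h0
      have htnzd : t ∈ nonZeroDivisors (blowupAlgebra (Ideal.span (Set.range c)) (c j)) :=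
        algebraMap_mem_nonZeroDivisors_blowupAlgebra
      have hm0 : (m : blowupAlgebra (Ideal.span (Set.range c)) (c j)) = 0 :=
        (mul_right_mem_nonZeroDivisors_eq_zero_iff htnzd).mp hm
      exact m.2 (by rw [hm0]; exact 𝔔.zero_mem)
    have hregL : IsRegularLocalRing (Localization.AtPrime 𝔔) := inferInstance
    exact @not_isRegularLocalRing_quotient_span_singleton_of_mem_sq (Localization.AtPrime 𝔔) _ hregL _ ht0 hmem key'
  · have hu : IsUnit (algebraMap (blowupAlgebra (Ideal.span (Set.range c)) (c j)) (Localization.AtPrime 𝔔) t) :=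
      IsLocalization.map_units (Localization.AtPrime 𝔔) (⟨t, ht𝔔⟩ : 𝔔.primeCompl)
    exact (IsLocalRing.mem_maximalIdeal _).mp (Ideal.pow_le_self two_ne_zero hmem) hu

/-! ## §2. The strict transform of `h = ĉ(c_{i₀}² + λ̂c_{i₁}²) + F(c)` and the cubic cone -/

/-- **The strict transform via the cubic form.** If `h = ĉ(c_{i₀}² + λ̂c_{i₁}²) + F(c)` with `F` a form of degree `3` (coefficients in
`R`) and `h = c_j²·h′` in `B = R[𝔪/c_j]`, then `h′ = ĉ(u² + λ̂v²) + (c_j/1)·F(c/c_j)`, `u = c_{i₀}/c_j`, `v = c_{i₁}/c_j`. [folklore] -/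
theorem strictTransform_eq_of_cubicForm {R : Type u} [CommRing R] {d : ℕ} (c : Fin d → R) {i₀ i₁ : Fin d} {h cc lam : R}
    {F : MvPolynomial (Fin d) R} (hF : F.IsHomogeneous 3) (hFh : MvPolynomial.eval c F = h - cc * (c i₀ ^ 2 + lam * c i₁ ^ 2))
    (j : Fin d) {h' : blowupAlgebra (Ideal.span (Set.range c)) (c j)}
    (hh' : algebraMap R (blowupAlgebra (Ideal.span (Set.range c)) (c j)) h =
      algebraMap R (blowupAlgebra (Ideal.span (Set.range c)) (c j)) (c j) ^ 2 * h') :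
    h' = algebraMap R (blowupAlgebra (Ideal.span (Set.range c)) (c j)) cc *
        (blowupAlgebra.frac c j i₀ ^ 2 +
          algebraMap R (blowupAlgebra (Ideal.span (Set.range c)) (c j)) lam * blowupAlgebra.frac c j i₁ ^ 2) +
      algebraMap R (blowupAlgebra (Ideal.span (Set.range c)) (c j)) (c j) * MvPolynomial.aeval (blowupAlgebra.frac c j) F := by
  have hcj : algebraMap R (blowupAlgebra (Ideal.span (Set.range c)) (c j)) (c j) ^ 2 ∈
      nonZeroDivisors (blowupAlgebra (Ideal.span (Set.range c)) (c j)) :=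
    pow_mem algebraMap_mem_nonZeroDivisors_blowupAlgebra 2
  have hu' : algebraMap R (blowupAlgebra (Ideal.span (Set.range c)) (c j)) (c i₀) =
      algebraMap R (blowupAlgebra (Ideal.span (Set.range c)) (c j)) (c j) * blowupAlgebra.frac c j i₀ :=
    (blowupAlgebra.algebraMap_mul_gen _ _ (c i₀) (blowupAlgebra.mem_span_range c i₀)).symm
  have hv' : algebraMap R (blowupAlgebra (Ideal.span (Set.range c)) (c j)) (c i₁) =
      algebraMap R (blowupAlgebra (Ideal.span (Set.range c)) (c j)) (c j) * blowupAlgebra.frac c j i₁ :=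
    (blowupAlgebra.algebraMap_mul_gen _ _ (c i₁) (blowupAlgebra.mem_span_range c i₁)).symm
  have hcone := algebraMap_eval_eq_pow_mul_coneTransform c j hF
  apply (mul_cancel_left_mem_nonZeroDivisors hcj).mp
  rw [← hh']
  have : h = cc * (c i₀ ^ 2 + lam * c i₁ ^ 2) + MvPolynomial.eval c F := by rw [hFh]; ring
  rw [this, map_add, hcone, map_mul, map_add, map_mul, map_pow, map_pow, hu', hv']
  ring

/-- **(N3a) «NEAR ⟺ THE CUBIC CONE PASSES THROUGH THE POINT».** In the situation of `strictTransform_eq_of_cubicForm`, with `R`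
regular local and `c` a regular system of parameters, at a prime `𝔔` of `B = R[𝔪/c_j]` containing `u = c_{i₀}/c_j` and
`v = c_{i₁}/c_j` (a point of the line `V(x̄_{i₀}, x̄_{i₁})` of the exceptional divisor, or a point off the exceptional divisor with
`u, v ∈ 𝔔`): `h′ ∈ 𝔔²B_𝔔 ⟺ F(c/c_j) ∈ 𝔔`. (`⇐`: both summands lie in `𝔔²`; `⇒`: otherwise `F(c/c_j)` is a unit at `𝔔` and
`c_j/1 = (h′ − ĉ(u² + λ̂v²))·F(c/c_j)⁻¹ ∈ 𝔪²`, contradicting `algebraMap_rsop_not_mem_maximalIdeal_sq`.)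
[OURS · L1 W4.2 · k2 · E2 chart calculus, brick 11] [folklore] -/
theorem strictTransform_mem_sq_iff_coneTransform_mem {R : Type u} [CommRing R] [IsRegularLocalRing R] {d : ℕ}
    (hd : (maximalIdeal R).spanFinrank = d) (c : Fin d → R) (hc : Ideal.span (Set.range c) = maximalIdeal R)
    {i₀ i₁ : Fin d} {h cc lam : R} {F : MvPolynomial (Fin d) R} (hF : F.IsHomogeneous 3)
    (hFh : MvPolynomial.eval c F = h - cc * (c i₀ ^ 2 + lam * c i₁ ^ 2)) (j : Fin d)
    (𝔔 : Ideal (blowupAlgebra (Ideal.span (Set.range c)) (c j))) [𝔔.IsPrime]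
    (ht𝔔 : algebraMap R (blowupAlgebra (Ideal.span (Set.range c)) (c j)) (c j) ∈ 𝔔)
    (hu : blowupAlgebra.frac c j i₀ ∈ 𝔔) (hv : blowupAlgebra.frac c j i₁ ∈ 𝔔)
    {h' : blowupAlgebra (Ideal.span (Set.range c)) (c j)}
    (hh' : algebraMap R (blowupAlgebra (Ideal.span (Set.range c)) (c j)) h =
      algebraMap R (blowupAlgebra (Ideal.span (Set.range c)) (c j)) (c j) ^ 2 * h') :
    algebraMap (blowupAlgebra (Ideal.span (Set.range c)) (c j)) (Localization.AtPrime 𝔔) h' ∈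
        maximalIdeal (Localization.AtPrime 𝔔) ^ 2 ↔
      MvPolynomial.aeval (blowupAlgebra.frac c j) F ∈ 𝔔 := by
  have heq := strictTransform_eq_of_cubicForm c hF hFh j hh'
  obtain ⟨G, hG⟩ : ∃ G, G = MvPolynomial.aeval (blowupAlgebra.frac c j) F := ⟨_, rfl⟩
  obtain ⟨t, ht⟩ : ∃ t, t = algebraMap R (blowupAlgebra (Ideal.span (Set.range c)) (c j)) (c j) := ⟨_, rfl⟩
  obtain ⟨alg, halg⟩ : ∃ alg, alg = algebraMap (blowupAlgebra (Ideal.span (Set.range c)) (c j)) (Localization.AtPrime 𝔔) :=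
    ⟨_, rfl⟩
  rw [← hG] at heq ⊢
  rw [← ht] at heq ht𝔔
  rw [← halg]
  -- the quadratic part lies in `𝔔²`
  have hquad : algebraMap R (blowupAlgebra (Ideal.span (Set.range c)) (c j)) cc *
        (blowupAlgebra.frac c j i₀ ^ 2 +
          algebraMap R (blowupAlgebra (Ideal.span (Set.range c)) (c j)) lam * blowupAlgebra.frac c j i₁ ^ 2) ∈ 𝔔 ^ 2 := by
    exact Ideal.mul_mem_left _ _ (Ideal.add_mem _ (Ideal.pow_mem_pow hu 2) (Ideal.mul_mem_left _ _ (Ideal.pow_mem_pow hv 2)))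
  have hmap : ∀ {z}, z ∈ 𝔔 ^ 2 → alg z ∈ maximalIdeal (Localization.AtPrime 𝔔) ^ 2 := fun {z} hz => by
    rw [halg, ← Localization.AtPrime.map_eq_maximalIdeal, ← Ideal.map_pow]
    exact Ideal.mem_map_of_mem _ hz
  constructor
  · intro hnear
    by_contra hG𝔔
    -- `G` is a unit at `𝔔`, so `t/1 ∈ 𝔪²`
    have hGu : IsUnit (alg G) := by
      rw [halg]; exact IsLocalization.map_units (Localization.AtPrime 𝔔) (⟨G, hG𝔔⟩ : 𝔔.primeCompl)
    have htG : alg (t * G) ∈ maximalIdeal (Localization.AtPrime 𝔔) ^ 2 := by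
      rw [heq, map_add] at hnear
      exact mem_of_add_mem_of_mem (A := Localization.AtPrime 𝔔) (maximalIdeal (Localization.AtPrime 𝔔) ^ 2) hnear (hmap hquad)
    rw [map_mul] at htG
    have ht2 : alg t ∈ maximalIdeal (Localization.AtPrime 𝔔) ^ 2 :=
      ((maximalIdeal (Localization.AtPrime 𝔔) ^ 2).mul_unit_mem_iff_mem hGu).mp htG
    rw [halg, ht] at ht2
    exact algebraMap_rsop_not_mem_maximalIdeal_sq hd c hc j 𝔔 ht2
  · intro hG𝔔
    rw [heq, map_add]
    refine (maximalIdeal (Localization.AtPrime 𝔔) ^ 2).add_mem (hmap hquad) (hmap ?_)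
    rw [pow_two]
    exact Ideal.mul_mem_mul ht𝔔 hG𝔔

/-! ## §3. On the line the cone may be restricted to the plane `x = y = 0` -/

/-- Evaluations of a polynomial at two tuples that agree modulo an ideal agree modulo the ideal. [folklore] -/
theorem aeval_sub_aeval_mem_of_forall_sub_mem {R : Type u} [CommRing R] {S : Type*} [CommRing S] [Algebra R S] {σ : Type*}
    (I : Ideal S) {a b : σ → S} (hab : ∀ k, a k - b k ∈ I) (F : MvPolynomial σ R) :
    MvPolynomial.aeval a F - MvPolynomial.aeval b F ∈ I := by
  rw [← Ideal.Quotient.eq_zero_iff_mem, map_sub, sub_eq_zero, MvPolynomial.map_aeval, MvPolynomial.map_aeval]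
  have hfun : (fun i => Ideal.Quotient.mk I (a i)) = fun i => Ideal.Quotient.mk I (b i) :=
    funext fun k => Ideal.Quotient.eq.mpr (hab k)
  rw [hfun]

/-- **On the line, the cone transform may be replaced by the restricted cubic.** If `c_{i₀}/c_j, c_{i₁}/c_j ∈ 𝔔` then
`F(c/c_j) ∈ 𝔔 ⟺ F|_{X_{i₀} = X_{i₁} = 0}(c/c_j) ∈ 𝔔` (the binary/ternary cubic `g₃` of the memo, evaluated at the remaining
fractions). [folklore] -/
theorem coneTransform_mem_iff_lineRestriction_mem {R : Type u} [CommRing R] {d : ℕ} (c : Fin d → R) {i₀ i₁ : Fin d} (j : Fin d)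
    (𝔔 : Ideal (blowupAlgebra (Ideal.span (Set.range c)) (c j)))
    (hu : blowupAlgebra.frac c j i₀ ∈ 𝔔) (hv : blowupAlgebra.frac c j i₁ ∈ 𝔔) (F : MvPolynomial (Fin d) R) :
    MvPolynomial.aeval (blowupAlgebra.frac c j) F ∈ 𝔔 ↔
      MvPolynomial.aeval (fun k => if k = i₀ ∨ k = i₁ then 0 else blowupAlgebra.frac c j k) F ∈ 𝔔 := by
  have hsub := aeval_sub_aeval_mem_of_forall_sub_mem 𝔔
    (a := blowupAlgebra.frac c j) (b := fun k => if k = i₀ ∨ k = i₁ then 0 else blowupAlgebra.frac c j k) (fun k => by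
      by_cases hk : k = i₀ ∨ k = i₁
      · simp only [hk, if_true, sub_zero]
        rcases hk with rfl | rfl
        · exact hu
        · exact hv
      · simp only [hk, if_false, sub_self, Submodule.zero_mem]) F
  constructor
  · intro h
    have := Ideal.sub_mem _ h hsub
    rwa [sub_sub_cancel] at this
  · intro h
    have := Ideal.add_mem _ hsub h
    rwa [sub_add_cancel] at this

end Summit.ResolutionOfSingularities.ResolutionOfSingularities.Cruxes.SigmaMaxModifications.IdeasL1C6.E2Chart

end
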